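import Mathlib
import Literature.AlgebraicGeometry.Resolution.LocalBlowup
import Literature.RingTheory.RegularLocalRing.QuotientDVR

/-!
# `RisoCurves` (stmt-ResolutionOfSingularities-18550), Part B.2: valuation rings of a function field
# of a curve versus discrete valuation subrings, and prime avoidance at a centre

Route `ResolutionOfSingularities/RisoStrata`, support item `RisoCurves`. Elementary lemmas for the
termination of point blow-ups along a valuation ring `O` of `K`:

* `valuationSubring_eq_of_dvr_le` — a valuation subring containing a DISCRETE valuation subring
  `V` of `K` is `V` or `K` (rank one);
* `toSubring_eq_of_dvr_subring` — the same for a subring `R ⊆ O` of `K` which is a DVR with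
  `Frac R = K`;
* `toSubring_eq_locAtCentre_of_isRegularLocalRing` — if a chart `B ⊆ O` (`Frac B = K`) is REGULAR
  at the centre of `O` and the centre is not the generic point, then `O = B_{𝔪_O ∩ B}`
  (a one-dimensional regular local ring is a DVR, `QuotientDVR.lean`, Matsumura 11.2);
* `exists_not_mem_forall_mem_of_finite` — prime avoidance: for finitely many maximal ideals and one
  of them `P`, an element outside `P` inside all the others;
* `finite_setOf_isMaximal_le` — in a Noetherian domain of dimension `≤ 1` a nonzero ideal lies in
  only finitely many maximal ideals.
-/

noncomputable section

set_option linter.dupNamespace false -- mandated namespace of this single-conjunct summit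

namespace Summit.ResolutionOfSingularities.ResolutionOfSingularities.Theorems

open Literature.AlgebraicGeometry.Resolution IsLocalRing

universe u

variable {K : Type u} [Field K]

/-- **A discrete valuation subring is maximal among proper valuation subrings**: if
`V ≤ O ≠ K` with `V` a DVR then `O = V`. (Otherwise some `z ∈ O ∖ V` has `z⁻¹ = u ϖⁿ`, `n ≥ 1`,
so `ϖ⁻¹ ∈ O` and then `K = V[ϖ⁻¹] ⊆ O`.) [folklore] -/
theorem valuationSubring_eq_of_dvr_le (V O : ValuationSubring K) [IsDiscreteValuationRing V]
    (hVO : V ≤ O) (hO : O ≠ ⊤) : O = V := by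
  refine le_antisymm ?_ hVO
  intro z hz
  by_contra hzV
  have hz0 : z ≠ 0 := by
    rintro rfl
    exact hzV V.zero_mem
  have hzi : z⁻¹ ∈ V := (V.mem_or_inv_mem z).resolve_left hzV
  obtain ⟨ϖ, hϖ⟩ := IsDiscreteValuationRing.exists_irreducible V
  have hϖ0 : (ϖ : K) ≠ 0 := fun h => hϖ.ne_zero (Subtype.ext h)
  -- `z⁻¹ = u ϖⁿ` with `n ≥ 1`
  set w : V := ⟨z⁻¹, hzi⟩ with hw
  have hw0 : w ≠ 0 := fun h => inv_ne_zero hz0 (congrArg Subtype.val h)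
  obtain ⟨n, u, hwu⟩ := IsDiscreteValuationRing.eq_unit_mul_pow_irreducible hw0 hϖ
  have hn : n ≠ 0 := by
    rintro rfl
    rw [pow_zero, mul_one] at hwu
    -- `w` is a unit, so `z ∈ V`
    apply hzV
    have hinv : ((u⁻¹ : Vˣ) : V).1 = z := by
      have h1 : ((u : V) : K) * (((u⁻¹ : Vˣ) : V) : K) = 1 := by
        rw [← Subring.coe_mul, Units.mul_inv]; rfl
      rw [← hwu] at h1
      change z⁻¹ * _ = 1 at h1
      have := inv_mul_cancel₀ hz0
      calc (((u⁻¹ : Vˣ) : V) : K) = z * (z⁻¹ * (((u⁻¹ : Vˣ) : V) : K)) := by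
            rw [← mul_assoc, mul_inv_cancel₀ hz0, one_mul]
        _ = z := by rw [h1, mul_one]
    rw [← hinv]
    exact ((u⁻¹ : Vˣ) : V).2
  obtain ⟨m, rfl⟩ := Nat.exists_eq_succ_of_ne_zero hn
  -- `(ϖ^{m+1})⁻¹ = u z ∈ O`, hence `ϖ⁻¹ = ϖ^m (ϖ^{m+1})⁻¹ ∈ O`
  have hVO' : ∀ y : V, (y : K) ∈ O := fun y => hVO y.2
  have hpow : ((ϖ : K) ^ (m + 1))⁻¹ ∈ O := by
    have hK : z⁻¹ = ((u : V) : K) * (ϖ : K) ^ (m + 1) := by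
      have := congrArg Subtype.val hwu
      simpa [hw] using this
    have hu0 : ((u : V) : K) ≠ 0 := fun h => u.ne_zero (Subtype.ext h)
    have hpow' : (ϖ : K) ^ (m + 1) = ((u : V) : K)⁻¹ * z⁻¹ := by
      rw [hK, ← mul_assoc, inv_mul_cancel₀ hu0, one_mul]
    rw [hpow', mul_inv, inv_inv, inv_inv]
    exact mul_mem (hVO' _) hz
  have hϖinv : (ϖ : K)⁻¹ ∈ O := by
    have : (ϖ : K)⁻¹ = (ϖ : K) ^ m * ((ϖ : K) ^ (m + 1))⁻¹ := by
      field_simp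
      ring
    rw [this]
    exact mul_mem (pow_mem (hVO' ϖ) m) hpow
  -- hence `O = K`
  apply hO
  ext y
  refine ⟨fun _ => ValuationSubring.mem_top y, fun _ => ?_⟩
  by_cases hyV : y ∈ V
  · exact hVO hyV
  · have hy0 : y ≠ 0 := by
      rintro rfl
      exact hyV V.zero_mem
    have hyi : y⁻¹ ∈ V := (V.mem_or_inv_mem y).resolve_left hyV
    set w' : V := ⟨y⁻¹, hyi⟩ with hw'
    have hw'0 : w' ≠ 0 := fun h => inv_ne_zero hy0 (congrArg Subtype.val h)
    obtain ⟨n', u', hwu'⟩ := IsDiscreteValuationRing.eq_unit_mul_pow_irreducible hw'0 hϖ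
    have hK : y⁻¹ = ((u' : V) : K) * (ϖ : K) ^ n' := by
      have := congrArg Subtype.val hwu'
      simpa [hw'] using this
    have hu1 : ((↑(u'⁻¹ : Vˣ) : V) : K) * ((u' : V) : K) = 1 := by
      rw [← Subring.coe_mul, Units.inv_mul]; rfl
    have : y = ((↑(u'⁻¹ : Vˣ) : V) : K) * ((ϖ : K)⁻¹) ^ n' := by
      rw [← inv_inv y, hK, mul_inv, inv_pow, eq_inv_of_mul_eq_one_left hu1]
    rw [this]
    exact mul_mem (hVO' _) (pow_mem hϖinv n')

/-- **A DVR `R ⊆ O` of `K` with `Frac R = K` is the valuation ring `O`** (unless `O = K`).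
[folklore] -/
theorem toSubring_eq_of_dvr_subring (R : Subring K) [IsDiscreteValuationRing R]
    (hfrac : ∀ z : K, ∃ a ∈ R, ∃ b ∈ R, b ≠ 0 ∧ z = a / b)
    (O : ValuationSubring K) (hRO : R ≤ O.toSubring) (hO : O ≠ ⊤) : O.toSubring = R := by
  haveI : FaithfulSMul R K := (faithfulSMul_iff_algebraMap_injective R K).mpr Subtype.val_injective
  haveI : IsFractionRing R K := IsFractionRing.of_field R K fun z => by
    obtain ⟨a, ha, b, hb, -, rfl⟩ := hfrac z
    exact ⟨⟨a, ha⟩, ⟨b, hb⟩, rfl⟩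
  have hmem : ∀ z : K, z ∈ R ∨ z⁻¹ ∈ R := by
    intro z
    rcases ValuationRing.isInteger_or_isInteger R z with ⟨y, hy⟩ | ⟨y, hy⟩
    · exact Or.inl (hy ▸ y.2)
    · exact Or.inr (hy ▸ y.2)
  let V : ValuationSubring K := { R with mem_or_inv_mem' := hmem }
  haveI : IsDiscreteValuationRing V :=
    IsDiscreteValuationRing.RingEquivClass.isDiscreteValuationRing (A := R) (B := V)
      ({ toFun := fun x => ⟨x.1, x.2⟩, invFun := fun x => ⟨x.1, x.2⟩, left_inv := fun _ => rfl,
         right_inv := fun _ => rfl, map_mul' := fun _ _ => rfl, map_add' := fun _ _ => rfl } :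
        R ≃+* V)
  have hVO : V ≤ O := fun z hz => hRO hz
  have := valuationSubring_eq_of_dvr_le V O hVO hO
  rw [this]

/-- **A chart regular at the centre of `O` already computes `O`.** Let `B ⊆ O` be a subring of
`K` with `Frac B = K`, `O ≠ K`, such that the local ring `B_{𝔪_O ∩ B}` (`locAtCentre B O`) is a
regular local ring of dimension one. Then `O = B_{𝔪_O ∩ B}` (Matsumura 11.2: it is a DVR, and a
DVR is a maximal proper valuation ring). [folklore] -/
theorem toSubring_eq_locAtCentre_of_isRegularLocalRing (B : Subring K) (O : ValuationSubring K)
    (hBO : B ≤ O.toSubring) (hO : O ≠ ⊤)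
    (hfrac : ∀ z : K, ∃ a ∈ B, ∃ b ∈ B, b ≠ 0 ∧ z = a / b)
    (hreg : IsRegularLocalRing (locAtCentre B O)) (hdim : ringKrullDim (locAtCentre B O) = 1) :
    O.toSubring = locAtCentre B O := by
  haveI := hreg
  haveI : IsDiscreteValuationRing (locAtCentre B O) :=
    Literature.RingTheory.RegularLocalRing.isDiscreteValuationRing_of_ringKrullDim_eq_one hdim
  refine toSubring_eq_of_dvr_subring (locAtCentre B O) (fun z => ?_) O (locAtCentre_le hBO) hO
  obtain ⟨a, ha, b, hb, hb0, rfl⟩ := hfrac z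
  exact ⟨a, le_locAtCentre B O ha, b, le_locAtCentre B O hb, hb0, rfl⟩

/-- **Prime avoidance at a point**: for a finite set `S` of maximal ideals and `P ∈ S` there is
`u ∉ P` lying in every other member of `S`. [folklore] -/
theorem exists_not_mem_forall_mem_of_finite {A : Type*} [CommRing A] {S : Set (Ideal A)}
    (hS : S.Finite) (hmax : ∀ m ∈ S, m.IsMaximal) (P : Ideal A) (hP : P.IsMaximal) :
    ∃ u : A, u ∉ P ∧ ∀ m ∈ S, m ≠ P → u ∈ m := by
  classical
  set F : Finset (Ideal A) := hS.toFinset.erase P with hF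
  have hFmem : ∀ m, m ∈ F ↔ m ∈ S ∧ m ≠ P := fun m => by
    rw [hF, Finset.mem_erase, Set.Finite.mem_toFinset, and_comm]
  have hnot : ¬ F.inf id ≤ P := by
    intro hle
    obtain ⟨m, hmF, hmP⟩ := (Ideal.IsPrime.inf_le' hP.isPrime).mp hle
    obtain ⟨hmS, hmne⟩ := (hFmem m).mp hmF
    exact hmne ((hmax m hmS).eq_of_le hP.ne_top hmP)
  obtain ⟨u, huF, huP⟩ := Set.not_subset.mp hnot
  refine ⟨u, huP, fun m hmS hmne => ?_⟩
  have : u ∈ F.inf id := huF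
  rw [Submodule.mem_finsetInf] at this
  exact this m ((hFmem m).mpr ⟨hmS, hmne⟩)

/-- In a Noetherian domain of dimension `≤ 1`, a nonzero ideal is contained in only finitely many
maximal ideals (they are minimal primes over it). [folklore] -/
theorem finite_setOf_isMaximal_le {A : Type*} [CommRing A] [IsDomain A] [IsNoetherianRing A]
    [Ring.DimensionLEOne A] (I : Ideal A) (hI : I ≠ ⊥) :
    {m : Ideal A | m.IsMaximal ∧ I ≤ m}.Finite := by
  refine (Ideal.finite_minimalPrimes_of_isNoetherianRing A I).subset ?_
  rintro m ⟨hm, hIm⟩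
  refine ⟨⟨hm.isPrime, hIm⟩, ?_⟩
  rintro q ⟨hq, hIq⟩ hqm
  have hq0 : q ≠ ⊥ := fun h => hI (le_bot_iff.mp (h ▸ hIq))
  exact ((hq.isMaximal hq0).eq_of_le hm.ne_top hqm).ge

end Summit.ResolutionOfSingularities.ResolutionOfSingularities.Theorems
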